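import Mathlib.RingTheory.Etale.Field
import Mathlib.RingTheory.Unramified.Pi
import Mathlib.RingTheory.PiTensorProduct
import Mathlib.LinearAlgebra.PiTensorProduct.Finite
import HarnessLib

/-!
# Finite tensor products of étale algebras over a field are finite products of fields

Classical commutative algebra, as in Knus–Merkurjev–Rost–Tignol, *The Book of Involutions*
(AMS Coll. Publ. 44, 1998), §18.A: Proposition (18.3) ((1) ⇔ (2): a finite-dimensional commutative
algebra over a field `F` is étale — i.e. stays reduced under every scalar extension, equivalently
(Mathlib) is formally unramified — iff it is isomorphic to a finite product `K₁ × ⋯ × K_r` of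
finite separable field extensions of `F`) and Theorem (18.4) ("the tensor product of étale
`F`-algebras corresponds to the direct product of `Γ`-sets", in particular
`L₁ ⊗ ⋯ ⊗ L_r` is étale for étale `L₁, …, L_r`); cf. Bourbaki, *Algèbre* V §6 Thm. 4. Recorded in
the generality the tree uses it (Mathlib's `Algebra.FormallyUnramified` as the hypothesis):

* `formallyUnramified_piTensorProduct` : for a finite index type `ι`, the tensor product
  `⨂[R] i, M i` of formally unramified commutative `R`-algebras is formally unramified
  (uniqueness of infinitesimal lifts is checked factor by factor through
  `PiTensorProduct.singleAlgHom`, using `PiTensorProduct.algHom_ext`);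
* `exists_algEquiv_pi_field_of_formallyUnramified` : a finite, formally unramified (= étale)
  commutative algebra over a field `K` is `K`-isomorphic to a finite product of finite separable
  field extensions of `K` (Mathlib `Algebra.FormallyEtale.iff_exists_algEquiv_prod`, repackaged
  with `Fintype` index and the finiteness of the factors);
* `piTensorProduct_exists_algEquiv_pi_field` and the field-flavoured
  `piTensorProduct_fields_exists_algEquiv_pi_field` : `⨂[K] i, M i` for finitely many finite
  étale `K`-algebras (resp. finite separable field extensions) `M i` is `K`-isomorphic to a finite
  product of finite separable field extensions of `K`; `isReduced_piTensorProduct` : it is reduced.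

Consumers: [IUTchIII] Prop. 3.1 (i) / Prop. 3.3 (i) (`Literature/IUT/LogThetaLattice/`), the
tensor-packet rings of [IUTchIV] §1 (`Literature/IUT/LogVolume/`). Mathlib supplies everything
except the first lemma; nothing here is specific to those consumers.
-/

namespace Literature.RingTheory.Etale

open scoped TensorProduct
open PiTensorProduct

universe u v w

/-- **A finite tensor product of formally unramified algebras is formally unramified.** For a
finite index type `ι` and formally unramified commutative `R`-algebras `M i`, the `R`-algebra
`⨂[R] i, M i` is formally unramified: two lifts `⨂ M i → B` of a homomorphism to `B ⧸ I`
(`I² = 0`) agree on each factor `M i → ⨂ M i` by unramifiedness of `M i`, hence agree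
(`PiTensorProduct.algHom_ext`). The cited source states this over a field (étale algebras are
stable under finite tensor products); the lifting argument proves it over any commutative base
ring. [cite: KnusEtAl1998, §18.A Thm. 18.4] -/
theorem formallyUnramified_piTensorProduct {R : Type u} [CommRing R] {ι : Type v} [Finite ι]
    (M : ι → Type w) [∀ i, CommRing (M i)] [∀ i, Algebra R (M i)]
    [∀ i, Algebra.FormallyUnramified R (M i)] :
    Algebra.FormallyUnramified R (⨂[R] i, M i) := by
  classical
  rw [Algebra.FormallyUnramified.iff_comp_injective]
  intro B _ _ I hI f₁ f₂ h
  refine PiTensorProduct.algHom_ext fun i => ?_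
  refine Algebra.FormallyUnramified.comp_injective I hI ?_
  change (Ideal.Quotient.mkₐ R I).comp (f₁.comp (singleAlgHom i)) =
    (Ideal.Quotient.mkₐ R I).comp (f₂.comp (singleAlgHom i))
  rw [← AlgHom.comp_assoc, ← AlgHom.comp_assoc]
  exact congrArg (fun g : (⨂[R] i, M i) →ₐ[R] B ⧸ I => g.comp (singleAlgHom i)) h

/-- **Structure of finite étale algebras over a field.** A commutative algebra `B` over a field
`K` which is finite-dimensional and formally unramified (equivalently: étale) is `K`-isomorphic
to a finite product `Π i, F i` of fields, each finite and separable over `K`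
(Mathlib `Algebra.FormallyEtale.iff_exists_algEquiv_prod`; Prop. (18.3), (1) ⇒ (2) of the cited
source). [cite: KnusEtAl1998, §18.A Prop. 18.3] -/
theorem exists_algEquiv_pi_field_of_formallyUnramified (K : Type u) [Field K] (B : Type v)
    [CommRing B] [Algebra K B] [Module.Finite K B] [Algebra.FormallyUnramified K B] :
    ∃ (ι : Type v) (_ : Fintype ι) (F : ι → Type v) (_ : ∀ i, Field (F i))
      (_ : ∀ i, Algebra K (F i)),
      (∀ i, Module.Finite K (F i) ∧ Algebra.IsSeparable K (F i)) ∧ Nonempty (B ≃ₐ[K] ∀ i, F i) := by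
  have : Algebra.FormallyEtale K B := .of_formallyUnramified_of_field K B
  obtain ⟨ι, _, F, _, _, e, hsep⟩ := (Algebra.FormallyEtale.iff_exists_algEquiv_prod K B).mp this
  exact ⟨ι, Fintype.ofFinite ι, F, ‹_›, ‹_›, fun i => ⟨Module.Finite.of_surjective
    ((LinearMap.proj i).comp e.toLinearMap) ((Function.surjective_eval i).comp e.surjective),
    hsep i⟩, ⟨e⟩⟩

/-- The ring-isomorphism form of `exists_algEquiv_pi_field_of_formallyUnramified`: a finite,
formally unramified commutative algebra over a field is ring-isomorphic to a finite product of
fields. [cite: KnusEtAl1998, §18.A Prop. 18.3] -/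
theorem exists_ringEquiv_pi_field_of_formallyUnramified (K : Type u) [Field K] (B : Type v)
    [CommRing B] [Algebra K B] [Module.Finite K B] [Algebra.FormallyUnramified K B] :
    ∃ (ι : Type v) (_ : Fintype ι) (F : ι → Type v) (_ : ∀ i, Field (F i)),
      Nonempty (B ≃+* ∀ i, F i) := by
  obtain ⟨ι, hι, F, hF, _, -, ⟨e⟩⟩ := exists_algEquiv_pi_field_of_formallyUnramified K B
  exact ⟨ι, hι, F, hF, ⟨e.toRingEquiv⟩⟩

section OverField

variable (K : Type u) [Field K] {ι : Type v} [Finite ι]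

/-- A finite tensor product of finite étale algebras over a field is reduced
(`formallyUnramified_piTensorProduct` and Mathlib `Algebra.FormallyUnramified.isReduced_of_field`;
Prop. (18.3) (1) with `K = F` applied to the étale algebra `L₁ ⊗ ⋯ ⊗ L_r` of Thm. (18.4)).
[cite: KnusEtAl1998, §18.A Prop. 18.3] -/
theorem isReduced_piTensorProduct (M : ι → Type w) [∀ i, CommRing (M i)] [∀ i, Algebra K (M i)]
    [∀ i, Module.Finite K (M i)] [∀ i, Algebra.FormallyUnramified K (M i)] :
    IsReduced (⨂[K] i, M i) := by
  have := formallyUnramified_piTensorProduct (R := K) M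
  exact Algebra.FormallyUnramified.isReduced_of_field K (⨂[K] i, M i)

/-- **`⊗` of finite étale algebras over a field is a product of fields.** For finitely many
commutative `K`-algebras `M i`, each finite-dimensional and formally unramified over the field
`K`, the tensor product `⨂[K] i, M i` is `K`-isomorphic to a finite product of fields, each finite
and separable over `K` (Thm. (18.4) with Prop. (18.3) (2) of the cited source).
[cite: KnusEtAl1998, §18.A Thm. 18.4] -/
theorem piTensorProduct_exists_algEquiv_pi_field (M : ι → Type w) [∀ i, CommRing (M i)]
    [∀ i, Algebra K (M i)] [∀ i, Module.Finite K (M i)]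
    [∀ i, Algebra.FormallyUnramified K (M i)] :
    ∃ (κ : Type (max u v w)) (_ : Fintype κ) (F : κ → Type (max u v w)) (_ : ∀ k, Field (F k))
      (_ : ∀ k, Algebra K (F k)),
      (∀ k, Module.Finite K (F k) ∧ Algebra.IsSeparable K (F k)) ∧
        Nonempty ((⨂[K] i, M i) ≃ₐ[K] ∀ k, F k) := by
  have := formallyUnramified_piTensorProduct (R := K) M
  exact exists_algEquiv_pi_field_of_formallyUnramified K (⨂[K] i, M i)

/-- **`⊗` of finite separable field extensions is a product of fields** (the case of
`piTensorProduct_exists_algEquiv_pi_field` in which every factor is a field): for finitely many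
finite separable extensions `M i` of a field `K`, `⨂[K] i, M i` is `K`-isomorphic to a finite
product of finite separable field extensions of `K`. [cite: KnusEtAl1998, §18.A Thm. 18.4] -/
theorem piTensorProduct_fields_exists_algEquiv_pi_field (M : ι → Type w) [∀ i, Field (M i)]
    [∀ i, Algebra K (M i)] [∀ i, FiniteDimensional K (M i)] [∀ i, Algebra.IsSeparable K (M i)] :
    ∃ (κ : Type (max u v w)) (_ : Fintype κ) (F : κ → Type (max u v w)) (_ : ∀ k, Field (F k))
      (_ : ∀ k, Algebra K (F k)),
      (∀ k, Module.Finite K (F k) ∧ Algebra.IsSeparable K (F k)) ∧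
        Nonempty ((⨂[K] i, M i) ≃ₐ[K] ∀ k, F k) := by
  have : ∀ i, Algebra.FormallyUnramified K (M i) := fun i =>
    Algebra.FormallyUnramified.of_isSeparable K (M i)
  exact piTensorProduct_exists_algEquiv_pi_field K M

/-- Over a field of characteristic zero separability is automatic: for finitely many finite
field extensions `M i` of a field `K` of characteristic `0`, `⨂[K] i, M i` is `K`-isomorphic to
a finite product of finite field extensions of `K`. [cite: KnusEtAl1998, §18.A Thm. 18.4] -/
theorem piTensorProduct_fields_exists_algEquiv_pi_field_of_charZero [CharZero K] (M : ι → Type w)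
    [∀ i, Field (M i)] [∀ i, Algebra K (M i)] [∀ i, FiniteDimensional K (M i)] :
    ∃ (κ : Type (max u v w)) (_ : Fintype κ) (F : κ → Type (max u v w)) (_ : ∀ k, Field (F k))
      (_ : ∀ k, Algebra K (F k)),
      (∀ k, Module.Finite K (F k) ∧ Algebra.IsSeparable K (F k)) ∧
        Nonempty ((⨂[K] i, M i) ≃ₐ[K] ∀ k, F k) := by
  have : ∀ i, Algebra.IsSeparable K (M i) := fun i => inferInstance
  exact piTensorProduct_fields_exists_algEquiv_pi_field K M

end OverField

end Literature.RingTheory.Etale
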